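import Summits.HodgeConjecture.HodgeConjecture.Theorems.F0P3cStCharTSWeylHypFibre        -- ★ p849559 (A0) `mem_torusU_iff_forall_apply_eq_zero`, (A0′), (A1), (A3) `exists_mem_normalizer_torusU_of_conj_eq_conj`
import Summits.HodgeConjecture.HodgeConjecture.Theorems.F0P3cStCharTSWeylHypNormaliser   -- ★ p849560 (A2) `mem_normalizer_torusU_antidiag_three_iff`, `antidiagonal_over_apply`
import HarnessLib

/-!
# F0 · P3c · line LH6 «StCharTS» — «WEYL-HYP★» STAGE (B1): THE 2-TO-1 CONJUGATION MAP `U∕T × T^{reg} → Ω` ON THE HYPERBOLIC SET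
# (sequel of ★ p849559 (A0)(A1)(A3) and ★ p849560 (A2)) [Rogawski1990 §12.5 p. 182; vanDijk1972 §2]

Cell `pub/hodgecm-mathlib`, crux H413 = `stmt-HodgeConjecture-24833` (`--supports` lane, helper), route HCCMUnconditional; seat LH1-p01 (g3), deal «WEYL-HYP★ (B1)» of
F0P3b-plan (g23) 2026-09-02T05:41:22Z (LH2-p01 (g3) holds (B0)∕(B2)).  THEOREMS ONLY, sorry-free, no definition ∕ instance ∕ notation ∕ named fact.

NOTATION (no `def`): `U := ↥(unitaryGroupOfForm σ J)` over ANY commutative ring `R`, endomorphism `σ`, form `J`; `T := torusU σ J` (the diagonal torus, ★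
`UnitaryGroupBorelInduction`); «`t ∈ T^{reg}`» := `t ∈ torusU σ J ∧ IsRegularElt (t : GL (Fin N) R)` (★ `LocalTransfer.IsRegularElt`: separable characteristic
polynomial); «`x ∈ Ω`» := `∃ g t, t ∈ torusU σ J ∧ IsRegularElt (t : GL (Fin N) R) ∧ g * t * g⁻¹ = x` (the HYPERBOLIC SET, the image of `q : U × T^{reg} → U`,
`(g, t) ↦ g t g⁻¹`); the WEYL ELEMENT is a variable `w : U` with `((w : GL (Fin 3) R) : Matrix _ _ R) = J` (★ p849560 `antidiagOne_mem_unitaryGroupOfForm` provides one).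

* §1 (any `R σ J N`) **`inv_mul_mul_eq_of_mem_torusU`** (`T` is abelian: `n⁻¹ t n = t`); (T1) **`isRegularElt_of_mem_hypSet`**, **`conj_mem_hypSet`** (`Ω` consists of regular elements and is
  conjugation-saturated); (T4) **`isRegularElt_coe_conj_iff`** (regularity is invariant under `t ↦ h t h⁻¹` in `U`); (T2) **`conj_eq_conj_iff`**: for `t, t′ ∈ T^{reg}`,
  `g t g⁻¹ = g′ t′ g′⁻¹ ↔ ∃ n ∈ N(T), t = n t′ n⁻¹ ∧ g′ = g n` (→ ★ (A3) + (A0′); ← algebra) — the fibres of `q` are `N(T)`-torsors.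
* §2 (`N = 3`, `J = Φ₃ = (StdForm.antidiagonal 3).over R`, `R` nontrivial field-like `hR`, i.e. the local FIELD at a non-split place) the WEYL ELEMENT: `w ∉ T`
  (**`weyl_not_mem_torusU`**), `w ∈ N(T)` (**`weyl_mem_normalizer`**, ★ (A2) ⇐), `w t w⁻¹ ∈ T` (**`conj_weyl_mem_torusU`**), anti-diagonal × anti-diagonal = diagonal
  (**`antidiag_mul_antidiag_apply_eq_zero`**, any `N`), hence `w n ∈ T` for every anti-diagonal `n` (**`weyl_mul_mem_torusU_of_antidiag`**).
* §3 (T3) THE 2-TO-1 STRUCTURE: **`fibre_dichotomy`** — if `g t g⁻¹ = g₀ t₀ g₀⁻¹` (`t, t₀ ∈ T^{reg}`) then EITHER `g₀⁻¹ g ∈ T ∧ t = t₀` OR `w g₀⁻¹ g ∈ T ∧ t = w t₀ w⁻¹`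
  ((T2) + (A2): the connecting `n ∈ N(T)` is diagonal or anti-diagonal); **`conj_eq_conj_weyl`** (the partner `(g₀ w⁻¹, w t₀ w⁻¹)` IS a preimage); **`fibre_cases_disjoint`**,
  **`coe_ne_coe_mul_weyl_inv`** (the two cosets `g₀T ≠ g₀w⁻¹T`); and the torsor count **`fibre_eq_pair`** ∕ **`ncard_fibre_eq_two`**: the fibre of
  `U∕T × T^{reg} → Ω` over `g₀ t₀ g₀⁻¹`, as a subset of `(U ⧸ T) × U`, is EXACTLY `{(g₀T, t₀), (g₀w⁻¹T, w t₀ w⁻¹)}`, of cardinality `2 = |N(T)∕T|` — the «½» of the Weyl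
  integration formula `∫_Ω φ = ½ ∫_{T^{reg}} |D(t)| ∫_{U∕T} φ(g t g⁻¹)` (stage (B), measure side: LH2-p01 (g3)∕heir).

HONEST LABEL: count-neutral group theory for the (WM)∕(HM)∕(TOR) road of the LH6 leaf; closes no organ.  HC_CM is proved only modulo the 7 printed citations (2 remaining:
hLiu418 = `stmt-HodgeConjecture-24832`, h413 = `stmt-HodgeConjecture-24833`) until rung 0 closes.

## References
* [Rogawski1990] J. D. Rogawski, *Automorphic Representations of Unitary Groups in Three Variables*, Ann. of Math. Stud. 123 (1990), §12.5 p. 182 (Weyl integration on the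
  split torus, the factor `½ = |W|⁻¹`), §1.10 p. 9, §3.1 p. 19.
* [vanDijk1972] G. van Dijk, *Computation of certain induced characters of `p`-adic groups*, Math. Ann. 199 (1972), §2 (the map `G∕T × T′ → G`, `|W|`-to-one).
* [SpringerLAG1998] T. A. Springer, *Linear Algebraic Groups*, 2nd ed. (1998), 7.1.5, 8.1.12 (3).
-/

set_option autoImplicit false
set_option linter.dupNamespace false

open Matrix Polynomial
open Literature.NumberTheory.Automorphic Literature.NumberTheory.Automorphic.UnitaryGroup Literature.NumberTheory.Rogawski1990
open Summit.HodgeConjecture.HodgeConjecture.Cruxes.H413.F0P3cStCharTSWeylHypFibre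
open Summit.HodgeConjecture.HodgeConjecture.Cruxes.H413.F0P3cStCharTSWeylHypNormaliser
open scoped MatrixGroups

namespace Summit.HodgeConjecture.HodgeConjecture.Cruxes.H413.F0P3cStCharTSWeylHypTorsor

/-! ## §1 Generic `R`, `σ`, `J`, `N`: the torus is abelian; (T1), (T4), (T2) -/

section Generic

variable {R : Type*} [CommRing R] (σ : R →+* R) {N : ℕ} (J : Matrix (Fin N) (Fin N) R)

/-- **`T` is abelian, conjugation form**: `n⁻¹ t n = t` for `t, n ∈ T = torusU σ J` (diagonal matrices commute: `↑t = glDiagonal d`, `↑n = glDiagonal d′`;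
any commutative `R`, any `σ`, `J`, `N` — the `Field`∕`Fin 3` case `t₁ t₂ = t₂ t₁` is ★ `UnitaryGroup.mul_comm_of_mem_torusU`). [cite: Rogawski1990, §1.10 p. 9] -/
theorem inv_mul_mul_eq_of_mem_torusU {t n : ↥(unitaryGroupOfForm σ J)} (ht : t ∈ torusU σ J) (hn : n ∈ torusU σ J) : n⁻¹ * t * n = t := by
  obtain ⟨d, hd⟩ := ht
  obtain ⟨d', hd'⟩ := hn
  have hd1 : glDiagonal N R d = (t : GL (Fin N) R) := by rw [hd, Subgroup.coe_subtype]
  have hd2 : glDiagonal N R d' = (n : GL (Fin N) R) := by rw [hd', Subgroup.coe_subtype]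
  have hcomm : t * n = n * t := by
    apply Subtype.ext
    change (t : GL (Fin N) R) * (n : GL (Fin N) R) = (n : GL (Fin N) R) * (t : GL (Fin N) R)
    rw [← hd1, ← hd2, ← map_mul, ← map_mul, mul_comm]
  rw [mul_assoc, hcomm, ← mul_assoc, inv_mul_cancel, one_mul]

/-- **(T4) regularity is invariant under conjugation in `U`**: `IsRegularElt ↑(h t h⁻¹) ↔ IsRegularElt ↑t` (★ `isRegularElt_conj_iff`). [cite: Rogawski1990, §3.1 p. 19] -/
theorem isRegularElt_coe_conj_iff (h t : ↥(unitaryGroupOfForm σ J)) :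
    IsRegularElt ((h * t * h⁻¹ : ↥(unitaryGroupOfForm σ J)) : GL (Fin N) R) ↔ IsRegularElt (t : GL (Fin N) R) := by
  rw [Subgroup.coe_mul, Subgroup.coe_mul, Subgroup.coe_inv]
  exact isRegularElt_conj_iff _ _

/-- **(T1) every element of the hyperbolic set `Ω = ⋃_g g T^{reg} g⁻¹` is regular.** [cite: Rogawski1990, §12.5 p. 182] -/
theorem isRegularElt_of_mem_hypSet {x : ↥(unitaryGroupOfForm σ J)}
    (hx : ∃ g t : ↥(unitaryGroupOfForm σ J), t ∈ torusU σ J ∧ IsRegularElt (t : GL (Fin N) R) ∧ g * t * g⁻¹ = x) :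
    IsRegularElt (x : GL (Fin N) R) := by
  obtain ⟨g, t, -, hreg, rfl⟩ := hx
  exact (isRegularElt_coe_conj_iff σ J g t).2 hreg

/-- **(T1) `Ω` is conjugation-saturated**: `x ∈ Ω ⇒ h x h⁻¹ ∈ Ω` (and `q (h g, t) = h · q(g, t) · h⁻¹`). [cite: Rogawski1990, §12.5 p. 182] -/
theorem conj_mem_hypSet {x : ↥(unitaryGroupOfForm σ J)}
    (hx : ∃ g t : ↥(unitaryGroupOfForm σ J), t ∈ torusU σ J ∧ IsRegularElt (t : GL (Fin N) R) ∧ g * t * g⁻¹ = x) (h : ↥(unitaryGroupOfForm σ J)) :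
    ∃ g t : ↥(unitaryGroupOfForm σ J), t ∈ torusU σ J ∧ IsRegularElt (t : GL (Fin N) R) ∧ g * t * g⁻¹ = h * x * h⁻¹ := by
  obtain ⟨g, t, ht, hreg, rfl⟩ := hx
  exact ⟨h * g, t, ht, hreg, by group⟩

/-- **(T1) `T^{reg} ⊆ Ω`** (`q (1, t) = t`). [cite: Rogawski1990, §12.5 p. 182] -/
theorem mem_hypSet_of_mem_torusU {t : ↥(unitaryGroupOfForm σ J)} (ht : t ∈ torusU σ J) (hreg : IsRegularElt (t : GL (Fin N) R)) :
    ∃ g t' : ↥(unitaryGroupOfForm σ J), t' ∈ torusU σ J ∧ IsRegularElt (t' : GL (Fin N) R) ∧ g * t' * g⁻¹ = t :=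
  ⟨1, t, ht, hreg, by group⟩

/-- **(T2) THE FIBRES OF `q : (g, t) ↦ g t g⁻¹` ARE `N(T)`-TORSORS**: for `t, t′ ∈ T^{reg}`, `g t g⁻¹ = g′ t′ g′⁻¹ ↔ ∃ n ∈ N(T), t = n t′ n⁻¹ ∧ g′ = g n`
(→: ★ (A3) `exists_mem_normalizer_torusU_of_conj_eq_conj` with the unit differences of ★ (A0′); ←: `g n t′ n⁻¹ g⁻¹ = g t g⁻¹`).
[cite: Rogawski1990, §12.5 p. 182] [cite: vanDijk1972, §2] -/
theorem conj_eq_conj_iff {t t' : ↥(unitaryGroupOfForm σ J)} (ht : t ∈ torusU σ J) (hreg : IsRegularElt (t : GL (Fin N) R))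
    (ht' : t' ∈ torusU σ J) (hreg' : IsRegularElt (t' : GL (Fin N) R)) (g g' : ↥(unitaryGroupOfForm σ J)) :
    g * t * g⁻¹ = g' * t' * g'⁻¹ ↔
      ∃ n ∈ Subgroup.normalizer (torusU σ J : Set ↥(unitaryGroupOfForm σ J)), t = n * t' * n⁻¹ ∧ g' = g * n := by
  constructor
  · intro h
    obtain ⟨d, hd⟩ := ht
    obtain ⟨d', hd'⟩ := ht'
    have hd1 : glDiagonal N R d = (t : GL (Fin N) R) := by rw [hd, Subgroup.coe_subtype]
    have hd2 : glDiagonal N R d' = (t' : GL (Fin N) R) := by rw [hd', Subgroup.coe_subtype]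
    have hregd : ∀ i j : Fin N, i ≠ j → IsUnit ((d i : R) - d j) := fun i j hij =>
      isUnit_sub_of_isRegularElt_glDiagonal (by rw [hd1]; exact hreg) hij
    have hregd' : ∀ i j : Fin N, i ≠ j → IsUnit ((d' i : R) - d' j) := fun i j hij =>
      isUnit_sub_of_isRegularElt_glDiagonal (by rw [hd2]; exact hreg') hij
    exact exists_mem_normalizer_torusU_of_conj_eq_conj σ J hd1 hregd hd2 hregd' h
  · rintro ⟨n, -, rfl, rfl⟩
    group

end Generic

/-! ## §2 `N = 3`, `J = Φ₃`, `R` field-like: the Weyl element `w` (matrix `Φ₃`) -/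

section Weyl

variable {R : Type*} [CommRing R] (σ : R →+* R)

/-- **anti-diagonal × anti-diagonal is diagonal** (any `N`): if `G i j = 0` unless `j = i.rev` and likewise for `H`, then `(G H) i j = 0` for `i ≠ j`. [folklore] -/
theorem antidiag_mul_antidiag_apply_eq_zero {N : ℕ} {G H : Matrix (Fin N) (Fin N) R}
    (hG : ∀ i j : Fin N, j ≠ i.rev → G i j = 0) (hH : ∀ i j : Fin N, j ≠ i.rev → H i j = 0) {i j : Fin N} (hij : i ≠ j) :
    (G * H) i j = 0 := by
  rw [Matrix.mul_apply, Finset.sum_eq_single i.rev]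
  · rw [hH i.rev j (fun h => hij (by rw [h, Fin.rev_rev])), mul_zero]
  · intro k _ hk
    rw [hG i k hk, zero_mul]
  · intro h
    exact absurd (Finset.mem_univ _) h

variable {J : Matrix (Fin 3) (Fin 3) R} {w : ↥(unitaryGroupOfForm σ J)}

/-- The Weyl element's matrix `Φ₃` is supported on the anti-diagonal. [cite: Rogawski1990, §1.9 p. 8] -/
theorem weyl_apply_eq_zero (hJ : J = (StdForm.antidiagonal 3).over R) (hw : ((w : GL (Fin 3) R) : Matrix (Fin 3) (Fin 3) R) = J)
    (i j : Fin 3) (hij : j ≠ i.rev) : ((w : GL (Fin 3) R) : Matrix (Fin 3) (Fin 3) R) i j = 0 := by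
  rw [hw, hJ, antidiagonal_over_apply, if_neg hij]

/-- **`w ∉ T`** (nontrivial `R`): the entry `(0, 2)` of `Φ₃` is `1 ≠ 0`, off the diagonal. [cite: Rogawski1990, §12.5 p. 182] -/
theorem weyl_not_mem_torusU [Nontrivial R] (hJ : J = (StdForm.antidiagonal 3).over R)
    (hw : ((w : GL (Fin 3) R) : Matrix (Fin 3) (Fin 3) R) = J) : w ∉ torusU σ J := by
  intro hwT
  have h := (mem_torusU_iff_forall_apply_eq_zero σ J w).1 hwT 0 2 (by decide)
  rw [hw, hJ, antidiagonal_over_apply, if_pos (by decide)] at h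
  exact one_ne_zero h

/-- **`w ∈ N(T)`** (★ (A2), ⇐ direction: an anti-diagonal element normalises the diagonal torus; `R` field-like with a regular element in `T`).
[cite: Rogawski1990, §12.5 p. 182] [cite: SpringerLAG1998, 7.1.5] -/
theorem weyl_mem_normalizer [Nontrivial R] (hR : ∀ x : R, x ≠ 0 → IsUnit x) (hJ : J = (StdForm.antidiagonal 3).over R)
    (hex : ∃ m : ↥(unitaryGroupOfForm σ J), m ∈ torusU σ J ∧ IsRegularElt (m : GL (Fin 3) R))
    (hw : ((w : GL (Fin 3) R) : Matrix (Fin 3) (Fin 3) R) = J) :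
    w ∈ Subgroup.normalizer (torusU σ J : Set ↥(unitaryGroupOfForm σ J)) :=
  (mem_normalizer_torusU_antidiag_three_iff σ hR hJ hex w).2 (Or.inr (weyl_apply_eq_zero σ hJ hw))

/-- **`w t w⁻¹ ∈ T` for `t ∈ T`.** [cite: Rogawski1990, §12.5 p. 182] -/
theorem conj_weyl_mem_torusU [Nontrivial R] (hR : ∀ x : R, x ≠ 0 → IsUnit x) (hJ : J = (StdForm.antidiagonal 3).over R)
    (hex : ∃ m : ↥(unitaryGroupOfForm σ J), m ∈ torusU σ J ∧ IsRegularElt (m : GL (Fin 3) R))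
    (hw : ((w : GL (Fin 3) R) : Matrix (Fin 3) (Fin 3) R) = J) {t : ↥(unitaryGroupOfForm σ J)} (ht : t ∈ torusU σ J) :
    w * t * w⁻¹ ∈ torusU σ J :=
  (Subgroup.mem_normalizer_iff.1 (weyl_mem_normalizer σ hR hJ hex hw) t).1 ht

/-- **`w n ∈ T` for every anti-diagonal `n ∈ U`** (anti-diagonal × anti-diagonal = diagonal, ★ (A0)). [cite: Rogawski1990, §12.5 p. 182] -/
theorem weyl_mul_mem_torusU_of_antidiag (hJ : J = (StdForm.antidiagonal 3).over R) (hw : ((w : GL (Fin 3) R) : Matrix (Fin 3) (Fin 3) R) = J)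
    {n : ↥(unitaryGroupOfForm σ J)} (hn : ∀ i j : Fin 3, j ≠ i.rev → ((n : GL (Fin 3) R) : Matrix (Fin 3) (Fin 3) R) i j = 0) :
    w * n ∈ torusU σ J := by
  rw [mem_torusU_iff_forall_apply_eq_zero]
  intro i j hij
  rw [Subgroup.coe_mul, Units.val_mul]
  exact antidiag_mul_antidiag_apply_eq_zero (weyl_apply_eq_zero σ hJ hw) hn hij

end Weyl

/-! ## §3 (T3) The map `U∕T × T^{reg} → Ω` is exactly 2-to-1, the partner given by `w` -/

section TwoToOne

variable {R : Type*} [CommRing R] (σ : R →+* R) {J : Matrix (Fin 3) (Fin 3) R} {w : ↥(unitaryGroupOfForm σ J)}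

/-- **(T3b) the partner IS a preimage**: `(g₀ w⁻¹) (w t₀ w⁻¹) (g₀ w⁻¹)⁻¹ = g₀ t₀ g₀⁻¹` (pure group algebra). [cite: vanDijk1972, §2] -/
theorem conj_eq_conj_weyl (g₀ t₀ w' : ↥(unitaryGroupOfForm σ J)) :
    g₀ * w'⁻¹ * (w' * t₀ * w'⁻¹) * (g₀ * w'⁻¹)⁻¹ = g₀ * t₀ * g₀⁻¹ := by
  group

/-- **(T3a) FIBRE DICHOTOMY.**  `N = 3`, `J = Φ₃`, `R` nontrivial field-like, `w` the Weyl element: if `g t g⁻¹ = g₀ t₀ g₀⁻¹` with `t, t₀ ∈ T^{reg}`, then EITHER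
`g ∈ g₀ T` and `t = t₀`, OR `g ∈ g₀ w⁻¹ T` and `t = w t₀ w⁻¹` — by (T2) the two presentations differ by `n ∈ N(T)`, which by ★ (A2) is diagonal (`n ∈ T`, and `T`
is abelian) or anti-diagonal (`w n ∈ T`). [cite: Rogawski1990, §12.5 p. 182] [cite: vanDijk1972, §2] -/
theorem fibre_dichotomy [Nontrivial R] (hR : ∀ x : R, x ≠ 0 → IsUnit x) (hJ : J = (StdForm.antidiagonal 3).over R)
    (hw : ((w : GL (Fin 3) R) : Matrix (Fin 3) (Fin 3) R) = J)
    {t₀ t g₀ g : ↥(unitaryGroupOfForm σ J)} (ht₀ : t₀ ∈ torusU σ J) (hreg₀ : IsRegularElt (t₀ : GL (Fin 3) R))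
    (ht : t ∈ torusU σ J) (hreg : IsRegularElt (t : GL (Fin 3) R)) (h : g * t * g⁻¹ = g₀ * t₀ * g₀⁻¹) :
    (g₀⁻¹ * g ∈ torusU σ J ∧ t = t₀) ∨ (w * g₀⁻¹ * g ∈ torusU σ J ∧ t = w * t₀ * w⁻¹) := by
  have hex : ∃ m : ↥(unitaryGroupOfForm σ J), m ∈ torusU σ J ∧ IsRegularElt (m : GL (Fin 3) R) := ⟨t₀, ht₀, hreg₀⟩
  -- the connecting element of the normaliser
  obtain ⟨n, hnN, htn, hgn⟩ := (conj_eq_conj_iff σ J ht₀ hreg₀ ht hreg g₀ g).1 h.symm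
  -- `htn : t₀ = n * t * n⁻¹`, `hgn : g = g₀ * n`
  have hg₀g : g₀⁻¹ * g = n := by rw [hgn, ← mul_assoc, inv_mul_cancel, one_mul]
  have htn' : t = n⁻¹ * t₀ * n := by rw [htn]; group
  rcases (mem_normalizer_torusU_antidiag_three_iff σ hR hJ hex n).1 hnN with hdiag | hanti
  · -- `n` diagonal: `n ∈ T`
    have hnT : n ∈ torusU σ J := (mem_torusU_iff_forall_apply_eq_zero σ J n).2 hdiag
    left
    refine ⟨by rw [hg₀g]; exact hnT, ?_⟩
    rw [htn', inv_mul_mul_eq_of_mem_torusU σ J ht₀ hnT]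
  · -- `n` anti-diagonal: `w n ∈ T`
    have hwn : w * n ∈ torusU σ J := weyl_mul_mem_torusU_of_antidiag σ hJ hw hanti
    right
    refine ⟨by rw [mul_assoc, hg₀g]; exact hwn, ?_⟩
    have hwt : w * t₀ * w⁻¹ ∈ torusU σ J := conj_weyl_mem_torusU σ hR hJ hex hw ht₀
    calc t = n⁻¹ * t₀ * n := htn'
      _ = (w * n)⁻¹ * (w * t₀ * w⁻¹) * (w * n) := by group
      _ = w * t₀ * w⁻¹ := inv_mul_mul_eq_of_mem_torusU σ J hwt hwn

/-- **(T3c) the two cases are disjoint**: `g₀⁻¹ g ∈ T` and `w g₀⁻¹ g ∈ T` together would put `w` in `T`. [cite: Rogawski1990, §12.5 p. 182] -/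
theorem fibre_cases_disjoint [Nontrivial R] (hJ : J = (StdForm.antidiagonal 3).over R) (hw : ((w : GL (Fin 3) R) : Matrix (Fin 3) (Fin 3) R) = J)
    (g₀ g : ↥(unitaryGroupOfForm σ J)) : ¬ (g₀⁻¹ * g ∈ torusU σ J ∧ w * g₀⁻¹ * g ∈ torusU σ J) := by
  rintro ⟨h1, h2⟩
  apply weyl_not_mem_torusU σ hJ hw
  have h3 : w * g₀⁻¹ * g * (g₀⁻¹ * g)⁻¹ ∈ torusU σ J := Subgroup.mul_mem _ h2 (Subgroup.inv_mem _ h1)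
  have e : w * g₀⁻¹ * g * (g₀⁻¹ * g)⁻¹ = w := by group
  rwa [e] at h3

/-- **(T3c) the two cosets differ**: `g₀ T ≠ g₀ w⁻¹ T` in `U ⧸ T` (left cosets; `(g₀ w⁻¹)⁻¹ g₀ = w ∉ T`). [cite: Rogawski1990, §12.5 p. 182] -/
theorem coe_ne_coe_mul_weyl_inv [Nontrivial R] (hJ : J = (StdForm.antidiagonal 3).over R) (hw : ((w : GL (Fin 3) R) : Matrix (Fin 3) (Fin 3) R) = J)
    (g₀ : ↥(unitaryGroupOfForm σ J)) :
    (g₀ : ↥(unitaryGroupOfForm σ J) ⧸ torusU σ J) ≠ ((g₀ * w⁻¹ : ↥(unitaryGroupOfForm σ J)) : ↥(unitaryGroupOfForm σ J) ⧸ torusU σ J) := by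
  intro h
  rw [QuotientGroup.eq] at h
  -- `h : g₀⁻¹ * (g₀ * w⁻¹) ∈ T`
  have e : g₀⁻¹ * (g₀ * w⁻¹) = w⁻¹ := by group
  rw [e] at h
  exact weyl_not_mem_torusU σ hJ hw ((Subgroup.inv_mem_iff _).1 h)

/-- **(T3) THE FIBRE OF `U∕T × T^{reg} → Ω` OVER `g₀ t₀ g₀⁻¹` IS THE PAIR `{(g₀T, t₀), (g₀w⁻¹T, w t₀ w⁻¹)}`** (as a subset of `(U ⧸ T) × U`; `N = 3`, `J = Φ₃`, `R`
nontrivial field-like). [cite: Rogawski1990, §12.5 p. 182] [cite: vanDijk1972, §2] -/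
theorem fibre_eq_pair [Nontrivial R] (hR : ∀ x : R, x ≠ 0 → IsUnit x) (hJ : J = (StdForm.antidiagonal 3).over R)
    (hw : ((w : GL (Fin 3) R) : Matrix (Fin 3) (Fin 3) R) = J)
    {t₀ : ↥(unitaryGroupOfForm σ J)} (ht₀ : t₀ ∈ torusU σ J) (hreg₀ : IsRegularElt (t₀ : GL (Fin 3) R)) (g₀ : ↥(unitaryGroupOfForm σ J)) :
    {p : (↥(unitaryGroupOfForm σ J) ⧸ torusU σ J) × ↥(unitaryGroupOfForm σ J) |
        (p.2 ∈ torusU σ J ∧ IsRegularElt (p.2 : GL (Fin 3) R)) ∧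
          ∃ g : ↥(unitaryGroupOfForm σ J), (g : ↥(unitaryGroupOfForm σ J) ⧸ torusU σ J) = p.1 ∧ g * p.2 * g⁻¹ = g₀ * t₀ * g₀⁻¹} =
      {((g₀ : ↥(unitaryGroupOfForm σ J) ⧸ torusU σ J), t₀),
        (((g₀ * w⁻¹ : ↥(unitaryGroupOfForm σ J)) : ↥(unitaryGroupOfForm σ J) ⧸ torusU σ J), w * t₀ * w⁻¹)} := by
  have hex : ∃ m : ↥(unitaryGroupOfForm σ J), m ∈ torusU σ J ∧ IsRegularElt (m : GL (Fin 3) R) := ⟨t₀, ht₀, hreg₀⟩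
  ext p
  obtain ⟨c, t⟩ := p
  simp only [Set.mem_setOf_eq, Set.mem_insert_iff, Set.mem_singleton_iff, Prod.mk.injEq]
  constructor
  · rintro ⟨⟨ht, hreg⟩, g, hgc, h⟩
    rcases fibre_dichotomy σ hR hJ hw ht₀ hreg₀ ht hreg h with ⟨h1, h2⟩ | ⟨h1, h2⟩
    · left
      refine ⟨?_, h2⟩
      rw [← hgc, eq_comm, QuotientGroup.eq]
      exact h1
    · right
      refine ⟨?_, h2⟩
      rw [← hgc, eq_comm, QuotientGroup.eq]
      have e : (g₀ * w⁻¹)⁻¹ * g = w * g₀⁻¹ * g := by group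
      rw [e]
      exact h1
  · rintro (⟨rfl, rfl⟩ | ⟨rfl, rfl⟩)
    · exact ⟨⟨ht₀, hreg₀⟩, g₀, rfl, rfl⟩
    · refine ⟨⟨conj_weyl_mem_torusU σ hR hJ hex hw ht₀, (isRegularElt_coe_conj_iff σ J w t₀).2 hreg₀⟩, g₀ * w⁻¹, rfl, ?_⟩
      exact conj_eq_conj_weyl σ g₀ t₀ w

/-- **(T3) CARDINALITY: every fibre of `U∕T × T^{reg} → Ω` has EXACTLY TWO points** — the «`|W| = |N(T)∕T| = 2`» behind the `½` of the Weyl integration formula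
on the hyperbolic set. [cite: Rogawski1990, §12.5 p. 182] [cite: vanDijk1972, §2] -/
theorem ncard_fibre_eq_two [Nontrivial R] (hR : ∀ x : R, x ≠ 0 → IsUnit x) (hJ : J = (StdForm.antidiagonal 3).over R)
    (hw : ((w : GL (Fin 3) R) : Matrix (Fin 3) (Fin 3) R) = J)
    {t₀ : ↥(unitaryGroupOfForm σ J)} (ht₀ : t₀ ∈ torusU σ J) (hreg₀ : IsRegularElt (t₀ : GL (Fin 3) R)) (g₀ : ↥(unitaryGroupOfForm σ J)) :
    {p : (↥(unitaryGroupOfForm σ J) ⧸ torusU σ J) × ↥(unitaryGroupOfForm σ J) |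
        (p.2 ∈ torusU σ J ∧ IsRegularElt (p.2 : GL (Fin 3) R)) ∧
          ∃ g : ↥(unitaryGroupOfForm σ J), (g : ↥(unitaryGroupOfForm σ J) ⧸ torusU σ J) = p.1 ∧ g * p.2 * g⁻¹ = g₀ * t₀ * g₀⁻¹}.ncard = 2 := by
  rw [fibre_eq_pair σ hR hJ hw ht₀ hreg₀ g₀]
  refine Set.ncard_pair fun h => ?_
  exact coe_ne_coe_mul_weyl_inv σ hJ hw g₀ (congrArg Prod.fst h)

/-- **(T3) surjectivity half, for the record**: every `x ∈ Ω` HAS a fibre point `(gT, t)` (by definition of `Ω`), so together with `ncard_fibre_eq_two` the map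
`U∕T × T^{reg} → Ω`, `(gT, t) ↦ g t g⁻¹`, is onto with all fibres of cardinality `2`. [cite: Rogawski1990, §12.5 p. 182] -/
theorem exists_fibre_point_of_mem_hypSet {x : ↥(unitaryGroupOfForm σ J)}
    (hx : ∃ g t : ↥(unitaryGroupOfForm σ J), t ∈ torusU σ J ∧ IsRegularElt (t : GL (Fin 3) R) ∧ g * t * g⁻¹ = x) :
    ∃ p : (↥(unitaryGroupOfForm σ J) ⧸ torusU σ J) × ↥(unitaryGroupOfForm σ J),
      (p.2 ∈ torusU σ J ∧ IsRegularElt (p.2 : GL (Fin 3) R)) ∧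
        ∃ g : ↥(unitaryGroupOfForm σ J), (g : ↥(unitaryGroupOfForm σ J) ⧸ torusU σ J) = p.1 ∧ g * p.2 * g⁻¹ = x := by
  obtain ⟨g, t, ht, hreg, rfl⟩ := hx
  exact ⟨((g : ↥(unitaryGroupOfForm σ J) ⧸ torusU σ J), t), ⟨ht, hreg⟩, g, rfl, rfl⟩

end TwoToOne

end Summit.HodgeConjecture.HodgeConjecture.Cruxes.H413.F0P3cStCharTSWeylHypTorsor
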